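import Mathlib
import Literature.Analysis.Complex.VerticalSinSummation
import HarnessLib

/-!
# HANDOFF — the FAR-ZONE potential bound of the dodger, on or off the critical line (rh-explicit, track «HANDOFF», seat prove-2 gen9, ATTEMPT-16 Lemma C2 (FAR))

HONEST FRAMING. Nothing here bears on the truth of RH; this is an elementary inequality about finite products. In ATTEMPT-16
(HOME/handoff/prove-2/ATTEMPT-16.md §4) the COST of the dodger witness is the sum over the UNKILLED zeros `ρ_j = 1/2 + i z_j`,
`z_j = γ_j + iη_j` (`|η_j| < 1/2`, `γ_j` above the horizon), of `|E(z_j)|²`, where off the lattice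
`E(z) = c_∞ · (sin bz/(bz)) · Π_{k ≤ K} (z² − z_k²)/(z² − ℓ_k²)`, the `z_k = γ_k + iη_k` being the KILLED zeros and `ℓ_k = πk/b` the
lattice. Lemma C2 (FAR) bounds one such term when `γ ≥ 2·max_k γ_k`: with `d_k := γ_k² − ℓ_k² > 0` (Lemma B1: every killed zero lies
above its lattice partner) and `D₁ := Σ_k d_k`,

  `Π_k |z² − z_k²|/|z² − ℓ_k²| ≤ exp(−(D₁ − (5/2)K)/γ²)`  and  `|sin bz/(bz)| ≤ cosh(b/2)/(bγ)`,

valid at every point `z = γ + iη` with `|η| ≤ 1/2` — i.e. at every unkilled zero ON OR OFF the critical line (theory-1's point (E6):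
the only off-line price is the factor `cosh(b/2)`, the exponent is untouched). THIS FILE proves exactly these two inequalities and
their product in the kernel (`farZone_prod_le`, `norm_sin_le_cosh_im`, `norm_sinc_le`, `farZone_normSq_le`; the identity
`‖sin z‖² = sin²(re z) + sinh²(im z)` is the tree's `Literature.Analysis.Complex.norm_sin_sq_eq`), for an arbitrary finite
family of nodes; the bookkeeping that feeds them (B1, B2, the summation C3) is elsewhere. Devices: `|z − z_k|² ≤ (γ − γ_k)²(1 + 4/γ²)`,
`|z + z_k|² ≤ (γ + γ_k)²(1 + 1/γ²)`, `(1 + 4x)(1 + x) ≤ (1 + 5x/2)²`, `1 − t ≤ e^{−t}`, `|sin(x+iy)|² = sin²x + sinh²y ≤ cosh²y`.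
No `sorry`, standard axioms, no definitions.

References: this track (ATTEMPT-16 §4, Lemma C2; DODGER-READING-NOTE (theory-1) point (E6)).
-/

set_option linter.dupNamespace false

open Real Finset Complex

namespace Summit.RiemannHypothesis.RiemannHypothesis.Theorems.Handoff

/-! ## The modulus of `sin` off the real axis -/

/-- `‖sin z‖ ≤ cosh(Im z)`. [folklore] -/
theorem norm_sin_le_cosh_im (z : ℂ) : ‖Complex.sin z‖ ≤ Real.cosh z.im := by
  have h1 := Literature.Analysis.Complex.norm_sin_sq_eq z
  have hc : Real.cosh z.im ^ 2 = Real.sinh z.im ^ 2 + 1 := Real.cosh_sq z.im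
  have hs : Real.sin z.re ^ 2 ≤ 1 := Real.sin_sq_le_one z.re
  have hpos : 0 < Real.cosh z.im := Real.cosh_pos z.im
  have h2 : ‖Complex.sin z‖ ^ 2 ≤ Real.cosh z.im ^ 2 := by nlinarith
  exact (pow_le_pow_iff_left₀ (norm_nonneg _) hpos.le two_ne_zero).1 h2

/-- **The `sinc` factor off the line.** For `b > 0` and `z = γ + iη` with `γ > 0`, `|η| ≤ 1/2`:
`‖sin(bz)‖/‖bz‖ ≤ cosh(b/2)/(bγ)`. (On the line, `η = 0`, the numerator bound is `1`.) [this track, ATTEMPT-16 Lemma C2] -/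
theorem norm_sinc_le {b γ η : ℝ} (hb : 0 < b) (hγ : 0 < γ) (hη : |η| ≤ 1 / 2) :
    ‖Complex.sin (b * (γ + η * I))‖ / ‖(b : ℂ) * (γ + η * I)‖ ≤ Real.cosh (b / 2) / (b * γ) := by
  have hre : ((γ : ℂ) + η * I).re = γ := by simp
  have hz : b * γ ≤ ‖(b : ℂ) * (γ + η * I)‖ := by
    rw [norm_mul, Complex.norm_real, Real.norm_eq_abs, abs_of_pos hb]
    refine mul_le_mul_of_nonneg_left ?_ hb.le
    have h := Complex.abs_re_le_norm ((γ : ℂ) + η * I)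
    rw [hre, abs_of_pos hγ] at h
    exact h
  have hnum : ‖Complex.sin (b * (γ + η * I))‖ ≤ Real.cosh (b / 2) := by
    refine (norm_sin_le_cosh_im _).trans ?_
    have him : ((b : ℂ) * (γ + η * I)).im = b * η := by simp
    rw [him, Real.cosh_le_cosh, abs_mul, abs_of_pos hb, abs_of_pos (by positivity : (0 : ℝ) < b / 2)]
    have : b * |η| ≤ b * (1 / 2) := mul_le_mul_of_nonneg_left hη hb.le
    linarith
  have hbγ : 0 < b * γ := by positivity
  calc ‖Complex.sin (b * (γ + η * I))‖ / ‖(b : ℂ) * (γ + η * I)‖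
      ≤ Real.cosh (b / 2) / ‖(b : ℂ) * (γ + η * I)‖ :=
        div_le_div_of_nonneg_right hnum (norm_nonneg _)
    _ ≤ Real.cosh (b / 2) / (b * γ) :=
        div_le_div_of_nonneg_left (Real.cosh_pos _).le hbγ hz

/-! ## One far-zone factor -/

/-- Real and imaginary parts of `(γ + iη)² − (γ' + iη')²` factor as `(z − z')(z + z')`; norms:
`‖z − z'‖² = (γ−γ')² + (η−η')²`, `‖z + z'‖² = (γ+γ')² + (η+η')²`. [folklore] -/
theorem normSq_sub_sq_eq (γ η γ' η' : ℝ) :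
    ‖((γ : ℂ) + η * I) ^ 2 - ((γ' : ℂ) + η' * I) ^ 2‖ ^ 2 =
      ((γ - γ') ^ 2 + (η - η') ^ 2) * ((γ + γ') ^ 2 + (η + η') ^ 2) := by
  have e : ((γ : ℂ) + η * I) ^ 2 - ((γ' : ℂ) + η' * I) ^ 2 =
      (((γ - γ' : ℝ) : ℂ) + ((η - η' : ℝ) : ℂ) * I) * (((γ + γ' : ℝ) : ℂ) + ((η + η' : ℝ) : ℂ) * I) := by
    push_cast; ring
  rw [e, norm_mul, mul_pow, Complex.sq_norm, Complex.sq_norm, Complex.normSq_add_mul_I,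
    Complex.normSq_add_mul_I]

/-- **One far-zone factor.** Let `0 < ℓ < γ'` (the killed zero `z' = γ' + iη'` lies above its lattice partner `ℓ`),
`|η'| ≤ 1/2`, and let `z = γ + iη` with `|η| ≤ 1/2`, `γ ≥ 2γ'`, `γ ≥ 2`. Then
`‖z² − z'²‖ / ‖z² − ℓ²‖ ≤ exp(−(γ'² − ℓ²)/γ² + (5/2)/γ²)`. [this track, ATTEMPT-16 Lemma C2 (FAR)] -/
theorem farZone_factor_le {ℓ γ' η' γ η : ℝ} (hℓ : 0 < ℓ) (hℓγ' : ℓ < γ') (hη' : |η'| ≤ 1 / 2)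
    (hη : |η| ≤ 1 / 2) (hfar : 2 * γ' ≤ γ) (hγ2 : 2 ≤ γ) :
    ‖((γ : ℂ) + η * I) ^ 2 - ((γ' : ℂ) + η' * I) ^ 2‖ / ‖((γ : ℂ) + η * I) ^ 2 - (ℓ : ℂ) ^ 2‖ ≤
      Real.exp (-(γ' ^ 2 - ℓ ^ 2) / γ ^ 2 + 5 / 2 / γ ^ 2) := by
  have hγ' : 0 < γ' := hℓ.trans hℓγ'
  have hγ : 0 < γ := by linarith only [hfar, hγ']
  have hγℓ : ℓ < γ := by linarith only [hℓγ', hfar, hγ']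
  have hx : 0 < γ ^ 2 := by positivity
  have ht0 : 0 ≤ 1 / γ ^ 2 := by positivity
  -- squared norms of numerator `A` and denominator `B`
  have hA2 := normSq_sub_sq_eq γ η γ' η'
  have hB2 : ‖((γ : ℂ) + η * I) ^ 2 - (ℓ : ℂ) ^ 2‖ ^ 2 = ((γ - ℓ) ^ 2 + η ^ 2) * ((γ + ℓ) ^ 2 + η ^ 2) := by
    have := normSq_sub_sq_eq γ η ℓ 0
    simpa using this
  -- `|η ± η'| ≤ 1`
  have hηη1 : (η - η') ^ 2 ≤ 1 :=
    (sq_le_one_iff_abs_le_one (η - η')).2 ((abs_sub η η').trans (by linarith))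
  have hηη2 : (η + η') ^ 2 ≤ 1 :=
    (sq_le_one_iff_abs_le_one (η + η')).2 ((abs_add_le η η').trans (by linarith))
  -- numerator: `A² ≤ P²`, `P = (γ² − γ'²)(1 + 5/(2γ²))`
  have hP0 : 0 ≤ γ ^ 2 - γ' ^ 2 := by nlinarith only [hfar, hγ']
  have hPnn : 0 ≤ (γ ^ 2 - γ' ^ 2) * (1 + 5 / 2 / γ ^ 2) := by positivity
  have hgg : (γ / 2) ^ 2 ≤ (γ - γ') ^ 2 := pow_le_pow_left₀ (by positivity) (by linarith only [hfar]) 2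
  have h1 : (γ - γ') ^ 2 + (η - η') ^ 2 ≤ (γ - γ') ^ 2 * (1 + 4 / γ ^ 2) := by
    have h3 : 1 ≤ (γ - γ') ^ 2 * 4 / γ ^ 2 := by
      rw [le_div_iff₀ hx]; nlinarith only [hgg]
    have e : (γ - γ') ^ 2 * (1 + 4 / γ ^ 2) = (γ - γ') ^ 2 + (γ - γ') ^ 2 * 4 / γ ^ 2 := by ring
    rw [e]; linarith only [h3, hηη1]
  have h2 : (γ + γ') ^ 2 + (η + η') ^ 2 ≤ (γ + γ') ^ 2 * (1 + 1 / γ ^ 2) := by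
    have h3 : 1 ≤ (γ + γ') ^ 2 / γ ^ 2 := by
      rw [le_div_iff₀ hx]; nlinarith only [hγ', hγ]
    have e : (γ + γ') ^ 2 * (1 + 1 / γ ^ 2) = (γ + γ') ^ 2 + (γ + γ') ^ 2 / γ ^ 2 := by ring
    rw [e]; linarith only [h3, hηη2]
  have h4 : (1 + 4 / γ ^ 2) * (1 + 1 / γ ^ 2) ≤ (1 + 5 / 2 / γ ^ 2) ^ 2 := by
    have key : ∀ t : ℝ, 0 ≤ t → (1 + 4 * t) * (1 + t) ≤ (1 + 5 / 2 * t) ^ 2 := fun t ht => by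
      nlinarith [sq_nonneg t]
    have e1 : 4 / γ ^ 2 = 4 * (1 / γ ^ 2) := by ring
    have e2 : 5 / 2 / γ ^ 2 = 5 / 2 * (1 / γ ^ 2) := by ring
    rw [e1, e2]; exact key _ ht0
  have hA_le : ‖((γ : ℂ) + η * I) ^ 2 - ((γ' : ℂ) + η' * I) ^ 2‖ ^ 2 ≤
      ((γ ^ 2 - γ' ^ 2) * (1 + 5 / 2 / γ ^ 2)) ^ 2 := by
    rw [hA2]
    calc ((γ - γ') ^ 2 + (η - η') ^ 2) * ((γ + γ') ^ 2 + (η + η') ^ 2)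
        ≤ ((γ - γ') ^ 2 * (1 + 4 / γ ^ 2)) * ((γ + γ') ^ 2 * (1 + 1 / γ ^ 2)) :=
          mul_le_mul h1 h2 (by positivity) (by positivity)
      _ = (γ ^ 2 - γ' ^ 2) ^ 2 * ((1 + 4 / γ ^ 2) * (1 + 1 / γ ^ 2)) := by ring
      _ ≤ (γ ^ 2 - γ' ^ 2) ^ 2 * (1 + 5 / 2 / γ ^ 2) ^ 2 :=
          mul_le_mul_of_nonneg_left h4 (by positivity)
      _ = ((γ ^ 2 - γ' ^ 2) * (1 + 5 / 2 / γ ^ 2)) ^ 2 := by ring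
  have hA_le' : ‖((γ : ℂ) + η * I) ^ 2 - ((γ' : ℂ) + η' * I) ^ 2‖ ≤
      (γ ^ 2 - γ' ^ 2) * (1 + 5 / 2 / γ ^ 2) :=
    (pow_le_pow_iff_left₀ (norm_nonneg _) hPnn two_ne_zero).1 hA_le
  -- denominator: `B ≥ Q = γ² − ℓ² > 0`
  have hQpos : 0 < γ ^ 2 - ℓ ^ 2 := by nlinarith only [hγℓ, hℓ]
  have hB_ge : (γ ^ 2 - ℓ ^ 2) ^ 2 ≤ ‖((γ : ℂ) + η * I) ^ 2 - (ℓ : ℂ) ^ 2‖ ^ 2 := by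
    rw [hB2]
    have h5 : (γ - ℓ) ^ 2 ≤ (γ - ℓ) ^ 2 + η ^ 2 := le_add_of_nonneg_right (sq_nonneg η)
    have h6 : (γ + ℓ) ^ 2 ≤ (γ + ℓ) ^ 2 + η ^ 2 := le_add_of_nonneg_right (sq_nonneg η)
    calc (γ ^ 2 - ℓ ^ 2) ^ 2 = (γ - ℓ) ^ 2 * (γ + ℓ) ^ 2 := by ring
      _ ≤ ((γ - ℓ) ^ 2 + η ^ 2) * ((γ + ℓ) ^ 2 + η ^ 2) :=
          mul_le_mul h5 h6 (by positivity) (by positivity)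
  have hB_ge' : γ ^ 2 - ℓ ^ 2 ≤ ‖((γ : ℂ) + η * I) ^ 2 - (ℓ : ℂ) ^ 2‖ :=
    (pow_le_pow_iff_left₀ hQpos.le (norm_nonneg _) two_ne_zero).1 hB_ge
  have hBpos : 0 < ‖((γ : ℂ) + η * I) ^ 2 - (ℓ : ℂ) ^ 2‖ := hQpos.trans_le hB_ge'
  -- the ratio
  have hratio : ‖((γ : ℂ) + η * I) ^ 2 - ((γ' : ℂ) + η' * I) ^ 2‖ / ‖((γ : ℂ) + η * I) ^ 2 - (ℓ : ℂ) ^ 2‖ ≤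
      (γ ^ 2 - γ' ^ 2) * (1 + 5 / 2 / γ ^ 2) / (γ ^ 2 - ℓ ^ 2) :=
    calc _ ≤ (γ ^ 2 - γ' ^ 2) * (1 + 5 / 2 / γ ^ 2) / ‖((γ : ℂ) + η * I) ^ 2 - (ℓ : ℂ) ^ 2‖ :=
          div_le_div_of_nonneg_right hA_le' hBpos.le
      _ ≤ _ := div_le_div_of_nonneg_left hPnn hQpos hB_ge'
  refine hratio.trans ?_
  -- `P/Q = (1 − d/Q)(1 + 5/(2γ²))` with `d = γ'² − ℓ² > 0` and `d/Q ≥ d/γ²`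
  have hd0 : 0 < γ' ^ 2 - ℓ ^ 2 := by nlinarith only [hℓγ', hℓ]
  have hPQ : (γ ^ 2 - γ' ^ 2) * (1 + 5 / 2 / γ ^ 2) / (γ ^ 2 - ℓ ^ 2) =
      (1 - (γ' ^ 2 - ℓ ^ 2) / (γ ^ 2 - ℓ ^ 2)) * (1 + 5 / 2 / γ ^ 2) := by
    field_simp
    ring
  rw [hPQ, Real.exp_add]
  have h7 : 1 - (γ' ^ 2 - ℓ ^ 2) / (γ ^ 2 - ℓ ^ 2) ≤ Real.exp (-(γ' ^ 2 - ℓ ^ 2) / γ ^ 2) := by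
    have h8 : (γ' ^ 2 - ℓ ^ 2) / γ ^ 2 ≤ (γ' ^ 2 - ℓ ^ 2) / (γ ^ 2 - ℓ ^ 2) :=
      div_le_div_of_nonneg_left hd0.le hQpos (by nlinarith only [hℓ])
    have h9 := Real.add_one_le_exp (-(γ' ^ 2 - ℓ ^ 2) / γ ^ 2)
    rw [neg_div] at h9 ⊢
    linarith only [h8, h9]
  have h10 : 1 + 5 / 2 / γ ^ 2 ≤ Real.exp (5 / 2 / γ ^ 2) := by
    have := Real.add_one_le_exp (5 / 2 / γ ^ 2); linarith only [this]
  have h11 : 0 ≤ 1 - (γ' ^ 2 - ℓ ^ 2) / (γ ^ 2 - ℓ ^ 2) := by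
    rw [sub_nonneg, div_le_one hQpos]; nlinarith only [hfar, hγ', hℓ]
  exact mul_le_mul h7 h10 (by positivity) (Real.exp_pos _).le

/-! ## The product over the killed zeros -/

/-- **ATTEMPT-16 Lemma C2 (FAR), the product (kernel).** For a finite family of killed zeros `z_k = γ_k + iη_k` above their lattice
partners `0 < ℓ_k < γ_k`, `|η_k| ≤ 1/2`, and a point `z = γ + iη`, `|η| ≤ 1/2`, with `γ ≥ 2γ_k` for all `k` and `γ ≥ 2`:
`Π_k ‖z² − z_k²‖/‖z² − ℓ_k²‖ ≤ exp(−(Σ_k (γ_k² − ℓ_k²) − (5/2)·#s)/γ²)`. [this track, ATTEMPT-16 Lemma C2 (FAR)] -/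
theorem farZone_prod_le {ι : Type*} (s : Finset ι) {ℓ γk ηk : ι → ℝ} {γ η : ℝ}
    (hℓ : ∀ k ∈ s, 0 < ℓ k) (hℓγ : ∀ k ∈ s, ℓ k < γk k) (hηk : ∀ k ∈ s, |ηk k| ≤ 1 / 2)
    (hη : |η| ≤ 1 / 2) (hfar : ∀ k ∈ s, 2 * γk k ≤ γ) (hγ2 : 2 ≤ γ) :
    ∏ k ∈ s, ‖((γ : ℂ) + η * I) ^ 2 - ((γk k : ℂ) + ηk k * I) ^ 2‖ / ‖((γ : ℂ) + η * I) ^ 2 - (ℓ k : ℂ) ^ 2‖ ≤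
      Real.exp (-((∑ k ∈ s, (γk k ^ 2 - ℓ k ^ 2)) - 5 / 2 * s.card) / γ ^ 2) := by
  have h1 : ∏ k ∈ s, ‖((γ : ℂ) + η * I) ^ 2 - ((γk k : ℂ) + ηk k * I) ^ 2‖ /
        ‖((γ : ℂ) + η * I) ^ 2 - (ℓ k : ℂ) ^ 2‖ ≤
      ∏ k ∈ s, Real.exp (-(γk k ^ 2 - ℓ k ^ 2) / γ ^ 2 + 5 / 2 / γ ^ 2) :=
    Finset.prod_le_prod (fun k _ => by positivity)
      fun k hk => farZone_factor_le (hℓ k hk) (hℓγ k hk) (hηk k hk) hη (hfar k hk) hγ2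
  refine h1.trans (le_of_eq ?_)
  rw [← Real.exp_sum]
  congr 1
  rw [Finset.sum_add_distrib, Finset.sum_const, nsmul_eq_mul]
  simp_rw [div_eq_mul_inv]
  rw [← Finset.sum_mul, Finset.sum_neg_distrib]
  ring

/-- **ATTEMPT-16 Lemma C2 (FAR), assembled (kernel).** Under the hypotheses of `farZone_prod_le` and `b > 0`:
`‖(sin bz/(bz)) · Π_k (z² − z_k²)/(z² − ℓ_k²)‖² ≤ (cosh²(b/2)/(b²γ²)) · exp(−2(D₁ − (5/2)#s)/γ²)`, `D₁ = Σ_k(γ_k² − ℓ_k²)` — the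
bound on `|E(z)|²/c_∞²` at an unkilled zero `1/2 + iz` in the far zone, on or off the critical line.
[this track, ATTEMPT-16 Lemma C2 (FAR)] -/
theorem farZone_normSq_le {ι : Type*} (s : Finset ι) {ℓ γk ηk : ι → ℝ} {γ η b : ℝ} (hb : 0 < b)
    (hℓ : ∀ k ∈ s, 0 < ℓ k) (hℓγ : ∀ k ∈ s, ℓ k < γk k) (hηk : ∀ k ∈ s, |ηk k| ≤ 1 / 2)
    (hη : |η| ≤ 1 / 2) (hfar : ∀ k ∈ s, 2 * γk k ≤ γ) (hγ2 : 2 ≤ γ) :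
    ‖Complex.sin (b * (γ + η * I)) / (b * (γ + η * I)) *
        ∏ k ∈ s, (((γ : ℂ) + η * I) ^ 2 - ((γk k : ℂ) + ηk k * I) ^ 2) / (((γ : ℂ) + η * I) ^ 2 - (ℓ k : ℂ) ^ 2)‖ ^ 2 ≤
      Real.cosh (b / 2) ^ 2 / (b ^ 2 * γ ^ 2) *
        Real.exp (-2 * ((∑ k ∈ s, (γk k ^ 2 - ℓ k ^ 2)) - 5 / 2 * s.card) / γ ^ 2) := by
  have hγ : 0 < γ := by linarith only [hγ2]
  rw [norm_mul, norm_div, norm_prod, mul_pow]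
  simp_rw [norm_div]
  have h1 := norm_sinc_le hb hγ hη
  have h2 := farZone_prod_le s hℓ hℓγ hηk hη hfar hγ2
  have h3 : (‖Complex.sin (b * (γ + η * I))‖ / ‖(b : ℂ) * (γ + η * I)‖) ^ 2 ≤
      Real.cosh (b / 2) ^ 2 / (b ^ 2 * γ ^ 2) :=
    calc (‖Complex.sin (b * (γ + η * I))‖ / ‖(b : ℂ) * (γ + η * I)‖) ^ 2
        ≤ (Real.cosh (b / 2) / (b * γ)) ^ 2 := pow_le_pow_left₀ (by positivity) h1 2
      _ = Real.cosh (b / 2) ^ 2 / (b ^ 2 * γ ^ 2) := by rw [div_pow, mul_pow]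
  have h4 : (∏ k ∈ s, ‖((γ : ℂ) + η * I) ^ 2 - ((γk k : ℂ) + ηk k * I) ^ 2‖ /
        ‖((γ : ℂ) + η * I) ^ 2 - (ℓ k : ℂ) ^ 2‖) ^ 2 ≤
      Real.exp (-2 * ((∑ k ∈ s, (γk k ^ 2 - ℓ k ^ 2)) - 5 / 2 * s.card) / γ ^ 2) := by
    have h5 := pow_le_pow_left₀ (Finset.prod_nonneg fun k _ => by positivity) h2 2
    refine h5.trans (le_of_eq ?_)
    rw [← Real.exp_nat_mul]
    congr 1
    push_cast
    ring
  exact mul_le_mul h3 h4 (by positivity) (by positivity)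

end Summit.RiemannHypothesis.RiemannHypothesis.Theorems.Handoff
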